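import Mathlib.Analysis.InnerProductSpace.PiL2
import HarnessLib

/-!
# Route `UnitScaleTilt`, crux K1 «MinimiserStabilityRegPr» (stmt-QuantumFields-19200), EX row `hGF[Lift]` (curved member) — **LOD LINE, PEN (L5″) FILE 2b-door (ABSTRACT):
# THE COORDINATE ROW (R-B) IS A VECTOR ROW** — for the massive columns `v^U_i = G_U(T_U(b_i))` over an orthonormal basis `b` of the coarse space (`G_U` symmetric, `S_U`
# the adjoint of `T_U`): `⟪v^U_i, h⟫ = ⟪b_i, S_U(G_U h)⟫`, hence by Parseval
# `Σ_i ‖⟪v^W_i, h⟫ − ⟪v^1_i, h⟫‖² = ‖S_W(G_W h) − S_1(G_1 h)‖²`, and the (R-B) row of ✓`Prop7ProjectorPerturbationGram` follows from TWO VECTOR ROWS on `h`: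
# (RB1) `‖G_W h − G_1 h‖ ≤ c_G‖h‖` (✓`Prop7CutoffResolventComparison` §4 twice, fed by px5's form rows) and (RB2) `‖(S_W − S_1)(G_1 h)‖ ≤ c_Q‖h‖` (ROW-T inside the cube ⊕ (A-L²) tails outside).

Cell `ym3-torus` (HUMAN RULING D-0037, YM ladder rung R3 — NOT d = 4, NOT infinite volume, NOT a mass gap, NOT Clay).  Width seat `ym-routeR-w3` gen 12; ★p1 g24
LOCATE-L6-ASSEMBLY §1 Step I.2 (L5″), road (α); this seat's LOCATE-L5pp-FILE2 (bce81fab) §1 (R-B).  THEOREMS ONLY (0 `def`, 0 `sorry`), Mathlib only; `--supports stmt-QuantumFields-19200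
--as helper`, count-neutral.  HONEST LABEL (★★OWNER RULING №33 (6)): curved γ-row supplier line (LOD localisation), pen (L5″); abstract Hilbert-space algebra — nothing of (3.49),
Thm 3.1∕3.3, `h349`, `hGF`, EX ∕ 19200 is proved here.  Member letters (routeR-w2 ✓`Prop7ComplementaryProjectorColumns`, px5 ✓`Prop7MassivePropagatorCoercive`): `E := SiteL2K`
(fine), `C := SiteL2K` of the coarse torus, `T := T`, `S := ι ∘ Q″`, `G := G_a` (✓`exists_massive_inverse`; symmetric as the inverse of a symmetric operator, ✓`inner_massive_inverse_symm`),
`b :=` px17's spike basis.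

WHAT IS PROVED (ns `Summit.QuantumFields.YangMills.Theorems.Prop7ColumnPairingRows`).
* §1 `inner_column_eq` (`⟪G(T c), h⟫ = ⟪c, S(G h)⟫`), `sum_normSq_inner_column_eq` (Bessel∕Parseval: `Σ_i‖⟪G(T(b_i)),h⟫‖² = ‖S(G h)‖²`), ★ `sqrt_sum_normSq_inner_column_le`
  (`≤ C_S·C_G·‖h‖` — the `hb`∕`ha′` rows of ✓`Prop7ProjectorPerturbationGram.norm_inner_starProjection_sub_le`).
* §2 ★★ `sum_normSq_inner_column_sub_eq` (`Σ_i‖⟪v^W_i,h⟫ − ⟪v^1_i,h⟫‖² = ‖S_W(G_W h) − S_1(G_1 h)‖²`), `norm_sub_le_of_cutoff_fixed` (`Xh = h` ⟹ `‖G_Wh − G_1h‖ ≤ ‖G_W(Xh) − X(G_1h)‖ +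
  ‖X(G_1h) − G_1(Xh)‖` — the two outputs of ✓`norm_inv_cutoff_comm_le_of_form`), ★★★ `sqrt_sum_normSq_inner_column_sub_le` (THE (R-B) ROW from (RB1)+(RB2): `≤ (C_S·c_G + c_Q)·‖h‖`).

References: T. Bałaban, CMP **99** (1985) 389–434 [Balaban1985BackgroundPropagators] ((3.16) p.393, (3.20)–(3.25) pp.394–395, (3.49) p.399).
-/

set_option autoImplicit false

noncomputable section

open scoped InnerProductSpace ComplexConjugate BigOperators

namespace Summit.QuantumFields.YangMills.Theorems.Prop7ColumnPairingRows

variable {E C : Type*} [NormedAddCommGroup E] [InnerProductSpace ℂ E] [NormedAddCommGroup C] [InnerProductSpace ℂ C] {ι : Type*} [Fintype ι]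

/-! ## §1 One system: the column pairings are the coordinates of `S(G h)` -/

/-- **`⟪G(T c), h⟫ = ⟪c, S(G h)⟫`** for `G` symmetric and `S` the adjoint of `T` (`⟪S l, c⟫ = ⟪l, T c⟫`). [cite: Balaban1985BackgroundPropagators, (3.16) p.393, (3.24) p.394] -/
theorem inner_column_eq (G : E →ₗ[ℂ] E) (T : C →ₗ[ℂ] E) (S : E →ₗ[ℂ] C) (hG : ∀ x y : E, ⟪G x, y⟫_ℂ = ⟪x, G y⟫_ℂ)
    (hT : ∀ (l : E) (c : C), ⟪S l, c⟫_ℂ = ⟪l, T c⟫_ℂ) (c : C) (h : E) : ⟪G (T c), h⟫_ℂ = ⟪c, S (G h)⟫_ℂ := by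
  rw [hG, ← inner_conj_symm, ← hT, inner_conj_symm]

/-- **BESSEL∕PARSEVAL FOR THE COLUMN PAIRINGS**: over an orthonormal basis `b` of the coarse space, `Σ_i ‖⟪G(T(b_i)), h⟫‖² = ‖S(G h)‖²`.
[cite: Balaban1985BackgroundPropagators, (3.16) p.393, (3.21) p.394] -/
theorem sum_normSq_inner_column_eq (b : OrthonormalBasis ι ℂ C) (G : E →ₗ[ℂ] E) (T : C →ₗ[ℂ] E) (S : E →ₗ[ℂ] C) (hG : ∀ x y : E, ⟪G x, y⟫_ℂ = ⟪x, G y⟫_ℂ)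
    (hT : ∀ (l : E) (c : C), ⟪S l, c⟫_ℂ = ⟪l, T c⟫_ℂ) (h : E) : ∑ i, ‖⟪G (T (b i)), h⟫_ℂ‖ ^ 2 = ‖S (G h)‖ ^ 2 := by
  simp_rw [inner_column_eq G T S hG hT]
  exact b.sum_sq_norm_inner_right _

/-- ★ **THE BESSEL ROW** (the `hb`∕`ha′` of ✓`Prop7ProjectorPerturbationGram.norm_inner_starProjection_sub_le`): `‖S l‖ ≤ C_S‖l‖`, `‖G h‖ ≤ C_G‖h‖` ⟹
`√(Σ_i ‖⟪G(T(b_i)), h⟫‖²) ≤ C_S·C_G·‖h‖`. [cite: Balaban1985BackgroundPropagators, (3.16) p.393, Thm 3.11 p.416] -/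
theorem sqrt_sum_normSq_inner_column_le (b : OrthonormalBasis ι ℂ C) (G : E →ₗ[ℂ] E) (T : C →ₗ[ℂ] E) (S : E →ₗ[ℂ] C) (hG : ∀ x y : E, ⟪G x, y⟫_ℂ = ⟪x, G y⟫_ℂ)
    (hT : ∀ (l : E) (c : C), ⟪S l, c⟫_ℂ = ⟪l, T c⟫_ℂ) {CS CG : ℝ} (hCS : 0 ≤ CS) (hS : ∀ l, ‖S l‖ ≤ CS * ‖l‖) (hGb : ∀ h, ‖G h‖ ≤ CG * ‖h‖) (h : E) :
    Real.sqrt (∑ i, ‖⟪G (T (b i)), h⟫_ℂ‖ ^ 2) ≤ CS * CG * ‖h‖ := by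
  rw [sum_normSq_inner_column_eq b G T S hG hT, Real.sqrt_sq (norm_nonneg _)]
  calc ‖S (G h)‖ ≤ CS * ‖G h‖ := hS _
    _ ≤ CS * (CG * ‖h‖) := mul_le_mul_of_nonneg_left (hGb h) hCS
    _ = CS * CG * ‖h‖ := by ring

/-! ## §2 Two systems: the (R-B) coordinate row is a vector row -/

/-- ★★ **THE (R-B) COORDINATE SUM IS A NORM**: for two systems `(G_W, T_W, S_W)`, `(G_1, T_1, S_1)` (symmetric `G`, adjoint pairs) and one orthonormal basis `b`,
`Σ_i ‖⟪G_W(T_W(b_i)), h⟫ − ⟪G_1(T_1(b_i)), h⟫‖² = ‖S_W(G_W h) − S_1(G_1 h)‖²`. [cite: Balaban1985BackgroundPropagators, (3.16) p.393, (3.21) p.394] -/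
theorem sum_normSq_inner_column_sub_eq (b : OrthonormalBasis ι ℂ C) (GW G1 : E →ₗ[ℂ] E) (TW T1 : C →ₗ[ℂ] E) (SW S1 : E →ₗ[ℂ] C)
    (hGW : ∀ x y : E, ⟪GW x, y⟫_ℂ = ⟪x, GW y⟫_ℂ) (hG1 : ∀ x y : E, ⟪G1 x, y⟫_ℂ = ⟪x, G1 y⟫_ℂ)
    (hTW : ∀ (l : E) (c : C), ⟪SW l, c⟫_ℂ = ⟪l, TW c⟫_ℂ) (hT1 : ∀ (l : E) (c : C), ⟪S1 l, c⟫_ℂ = ⟪l, T1 c⟫_ℂ) (h : E) :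
    ∑ i, ‖⟪GW (TW (b i)), h⟫_ℂ - ⟪G1 (T1 (b i)), h⟫_ℂ‖ ^ 2 = ‖SW (GW h) - S1 (G1 h)‖ ^ 2 := by
  simp_rw [inner_column_eq GW TW SW hGW hTW, inner_column_eq G1 T1 S1 hG1 hT1, ← inner_sub_right]
  exact b.sum_sq_norm_inner_right _

/-- **SPLITTING (RB1) THROUGH A CUTOFF THAT FIXES `h`**: if `X h = h` then `‖G_W h − G_1 h‖ ≤ ‖G_W(X h) − X(G_1 h)‖ + ‖X(G_1 h) − G_1(X h)‖` — the two outputs of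
✓`Prop7CutoffResolventComparison.norm_inv_cutoff_comm_le_of_form` at `(A_W, A_1, X)` and at `(A_1, A_1, X)` (the flat commutator). [cite: Balaban1985BackgroundPropagators, (3.105) p.414] -/
theorem norm_sub_le_of_cutoff_fixed (GW G1 X : E →ₗ[ℂ] E) (h : E) (hX : X h = h) :
    ‖GW h - G1 h‖ ≤ ‖GW (X h) - X (G1 h)‖ + ‖X (G1 h) - G1 (X h)‖ := by
  have e : GW h - G1 h = (GW (X h) - X (G1 h)) + (X (G1 h) - G1 (X h)) := by rw [hX]; abel
  rw [e]; exact norm_add_le _ _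

/-- ★★★ **THE (R-B) ROW FROM TWO VECTOR ROWS**: `‖S_W l‖ ≤ C_S‖l‖`, (RB1) `‖G_W h − G_1 h‖ ≤ c_G‖h‖`, (RB2) `‖S_W(G_1 h) − S_1(G_1 h)‖ ≤ c_Q‖h‖` ⟹
**`√(Σ_i ‖⟪G_W(T_W(b_i)), h⟫ − ⟪G_1(T_1(b_i)), h⟫‖²) ≤ (C_S·c_G + c_Q)·‖h‖`** — the `h1f`∕`h1g` rows of ✓`Prop7ProjectorPerturbationGram.norm_inner_starProjection_sub_le` at the member
(`S_W(G_Wh) − S_1(G_1h) = S_W(G_Wh − G_1h) + (S_W − S_1)(G_1h)`). [cite: Balaban1985BackgroundPropagators, (3.21) p.394, (3.49) p.399] -/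
theorem sqrt_sum_normSq_inner_column_sub_le (b : OrthonormalBasis ι ℂ C) (GW G1 : E →ₗ[ℂ] E) (TW T1 : C →ₗ[ℂ] E) (SW S1 : E →ₗ[ℂ] C)
    (hGW : ∀ x y : E, ⟪GW x, y⟫_ℂ = ⟪x, GW y⟫_ℂ) (hG1 : ∀ x y : E, ⟪G1 x, y⟫_ℂ = ⟪x, G1 y⟫_ℂ)
    (hTW : ∀ (l : E) (c : C), ⟪SW l, c⟫_ℂ = ⟪l, TW c⟫_ℂ) (hT1 : ∀ (l : E) (c : C), ⟪S1 l, c⟫_ℂ = ⟪l, T1 c⟫_ℂ)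
    {CS cG cQ : ℝ} (hCS : 0 ≤ CS) (hS : ∀ l, ‖SW l‖ ≤ CS * ‖l‖) (h : E)
    (hRB1 : ‖GW h - G1 h‖ ≤ cG * ‖h‖) (hRB2 : ‖SW (G1 h) - S1 (G1 h)‖ ≤ cQ * ‖h‖) :
    Real.sqrt (∑ i, ‖⟪GW (TW (b i)), h⟫_ℂ - ⟪G1 (T1 (b i)), h⟫_ℂ‖ ^ 2) ≤ (CS * cG + cQ) * ‖h‖ := by
  rw [sum_normSq_inner_column_sub_eq b GW G1 TW T1 SW S1 hGW hG1 hTW hT1 h, Real.sqrt_sq (norm_nonneg _)]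
  have e : SW (GW h) - S1 (G1 h) = SW (GW h - G1 h) + (SW (G1 h) - S1 (G1 h)) := by rw [map_sub]; abel
  rw [e]
  calc ‖SW (GW h - G1 h) + (SW (G1 h) - S1 (G1 h))‖ ≤ ‖SW (GW h - G1 h)‖ + ‖SW (G1 h) - S1 (G1 h)‖ := norm_add_le _ _
    _ ≤ CS * ‖GW h - G1 h‖ + cQ * ‖h‖ := add_le_add (hS _) hRB2
    _ ≤ CS * (cG * ‖h‖) + cQ * ‖h‖ := by gcongr
    _ = (CS * cG + cQ) * ‖h‖ := by ring

end Summit.QuantumFields.YangMills.Theorems.Prop7ColumnPairingRows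

end
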